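import Literature.Computability.Cryptography.Postselection
import Literature.Computability.Cryptography.QuantumCircuitProofs
import Literature.Computability.QuantumComplexity.CWrapAssembly
import Literature.Computability.QuantumComplexity.SimUniformity
import Literature.Computability.Complexity.StringCopy
import HarnessLib

/-!
# `PostBPP ⊆ PostBQP` (proof; trunk CryptoQuantFine, outline Q4)

Sibling proof file of `Postselection.lean` (D-0014). It discharges the named fact
`Literature.Computability.Cryptography.PostBPP_subset_PostBQP` (`PostBPP_subset_PostBQP_holds`):
post-selected bounded-error probabilistic polynomial time (`PostBPP`, Han–Hemaspaandra–Thierauf's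
`BPP_path`, the tree's random-string form with predicates `R, S ∈ P` read on `⟨x, r⟩`,
`r ∈ {0,1}^{p|x|}`) is contained in Aaronson's `PostBQP` (poly-time uniform oracle-free
Clifford+T families, post-selection wire `1`, output wire `0`, thresholds `2/3`, `1/3`).

## The printed argument, as formalised

Aaronson (Proc. R. Soc. A 461 (2005), §2) introduces `BPP_path` as what one obtains "if we add
postselection to a classical probabilistic polynomial-time Turing machine", the classical
analogue of `PostBQP` (Def. 1, §3); the inclusion `PostBPP ⊆ PostBQP` is the standard remark that
a post-selected *quantum* circuit can run the classical randomised computation — Hadamard gates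
manufacture the uniform coins and the deterministic polynomial-time predicates are computed
reversibly (Bernstein–Vazirani 1997, Thm. 8.3 `BPP ⊆ BQP` and §8: polynomial-time classical
computation is free inside quantum circuits) — used verbatim by Bremner–Jozsa–Shepherd
(Proc. R. Soc. A 467 (2011), proof of Thm. 2, arXiv p. 8: "theorem 1 (together with
post-BPP ⊆ post-BQP) will give post-BPP = PP"; Def. 3: post-BPP = uniform randomised classical
circuits with an output register and a post-selection register).

The formalisation assembles the quantum family from the tree's proved toolkit:

* **coins**: the family `PostBPPSim.hadFamily` (one Hadamard gate on each input wire, no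
  ancillas), oracle-free and *uniform* (`hadFamily_isUniform`: a three-line generator program,
  `QCircuitFamily.isUniform_of_gen`), which on the input `0^k` outputs a uniformly random string
  of length `k` (`hadFamily_kernelProb`: `Pr[output ∈ E] = uniformProb k E`, from
  `hadamards_mulVec_basisState` and the Born rule `toReal_outputPMF_map_ofFn`);
* **classical wrapping** (`CWrap.family`, `CWrapAssembly.lean`, the tree's discharge of
  `isQSolvable_classicalWrap`: "`P`-computations are free inside `BQP`", BV97 §8): the
  pre-processor `x ↦ 0^{p|x|}` (`coinZeros ∈ FP`) feeds the coin source, and the post-processor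
  `⟨x, r⟩ ↦ [r ∈ R] [r ∈ S]` (`twoBits ∈ FP`, the two deciding machines) writes the accept bit on
  wire `0` and the post-selection bit on wire `1`; the wrapped family is oracle-free and uniform,
  and `CWrap.kernelProb_family_ge` bounds, for *every* event `E` on the coins,
  `Pr_r[r ∈ E] ≤ Pr[output has a prefix [r ∈ R][r ∈ S], r ∈ E]`;
* **exactness**: applied to `E = {r | ⟨x,r⟩ ∈ S}` and to its complement (whose images sit in the
  disjoint string events "symbol `1` is `1`" / "symbol `1` is `0`"), and since the kernel
  probabilities of disjoint events sum to at most `1` (unitarity, `normSq_runOn_basisState`),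
  `Pr[post = 1] = Pr_r[⟨x,r⟩ ∈ S]` exactly, and likewise
  `Pr[out = 1 ∧ post = 1] = Pr_r[⟨x,r⟩ ∈ S ∧ ⟨x,r⟩ ∈ R]`
  (`postselectProbOn_eq_kernelProb`, `jointAcceptProbOn_eq_kernelProb`);
* the thresholds of `PostBPP` (multiplicative form) become those of `PostBQP` (conditional
  probability) because `Pr_r[⟨x,r⟩ ∈ S] > 0`.

## References

* S. Aaronson, *Quantum computing, postselection, and probabilistic polynomial-time*,
  Proc. R. Soc. A 461 (2005) 3473–3482, doi:10.1098/rspa.2005.1546, arXiv:quant-ph/0412187: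
  §2 (`BPP_path` as classical post-selection), §3 Def. 1 (`PostBQP`).
* M. J. Bremner, R. Jozsa, D. J. Shepherd, *Classical simulation of commuting quantum
  computations implies collapse of the polynomial hierarchy*, Proc. R. Soc. A 467 (2011)
  459–472, arXiv:1005.1407: Def. 3 (post-BPP, post-BQP), proof of Thm. 2 (p. 8 of the arXiv
  text: "post-BPP ⊆ post-BQP"), §2.4 (`BPP_path` = post-BPP).
* E. Bernstein, U. Vazirani, *Quantum complexity theory*, SIAM J. Comput. 26 (1997), Thm. 8.3
  (`BPP ⊆ BQP`: Hadamard coins and a reversible simulation) and §8.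
* Y. Han, L. A. Hemaspaandra, T. Thierauf, *Threshold computation and cryptographic security*,
  SIAM J. Comput. 26 (1997), Def. 2.2 (`BPP_path`).
* M. A. Nielsen, I. L. Chuang, *Quantum Computation and Quantum Information*, CUP 2010, §1.4.4
  (`H^{⊗k}|0^k⟩`), §2.2.5 (Born rule).
* S. Arora, B. Barak, *Computational Complexity: A Modern Approach*, CUP 2009, §6.2 Def. 6.12
  (`P`-uniform families), §0.1 (pairing).
-/

noncomputable section

namespace Literature.Computability.Cryptography

open _root_.Computability Complexity Complexity.Classes QuantumComplexity Matrix

namespace PostBPPSim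

/-! ### The Hadamard coin source -/

/-- **The coin source**: on inputs of length `k`, one Hadamard gate on each of the `k` input
wires and no ancillas. [Bernstein–Vazirani 1997, proof of Thm. 8.3 (Fourier transform of the
coin track); Nielsen–Chuang 2010, §1.4.4] [cite: BernsteinVazirani1997, Thm. 8.3 (proof)] -/
def hadFamily : QCircuitFamily cliffordT where
  ancillas _ := 0
  circ k := ⟨(List.finRange k).map hOn⟩

/-- The coin source has no ancillas (definitional). [folklore] -/
@[simp] theorem hadFamily_ancillas (n : ℕ) : hadFamily.ancillas n = 0 := rfl

/-- The coin source is oracle-free. [folklore] -/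
theorem hadFamily_isOracleFree : hadFamily.IsOracleFree := by
  intro k g hg
  obtain ⟨i, -, rfl⟩ := List.mem_map.1 hg
  exact hOn_isOracleFree i

/-- **Tokens of the coin source**: one `H` record on each wire `j < k`.
[cite: AroraBarakCC2009, §6.1] -/
theorem circTok_hadFamily (k : ℕ) :
    circTok (hadFamily.circ k) = (List.range k).flatMap fun j => BPPSim.gate1Tok 0 j := by
  show ((List.finRange k).map hOn).flatMap gateTok = _
  rw [List.flatMap_map, ← BPPSim.finRange_flatMap_val k fun j => BPPSim.gate1Tok 0 j]
  refine List.flatMap_congr fun (j : Fin k) _ => ?_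
  simp [BPPSim.gateTok_hOn]

/-! ### Uniformity of the coin source: a generator program -/

namespace HadGen

open BPPSim BPPSim.SimGen

/-- **The generator of the description stream** of the coin source: `n` in unary, the
separator, the empty unary ancilla count, the separator, then for `j < n` the record of `H` on
wire `j`. [cite: AroraBarakCC2009, §6.2 Def. 6.12] -/
def gen : SimStmt :=
  seqs [numS (GExpr.var SVar.N0) false, GStmt.emit (lits [false, true] ++ lits [false, true]),
    GStmt.loop SVar.J (GExpr.var SVar.N0) (g1S 0 (GExpr.var SVar.J))]

/-- The loop indices of the generator are `Z, J`, never reused. [folklore] -/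
theorem gok_gen : GOK [SVar.Z, SVar.J] gen :=
  gok_seqs fun s hs => by
    simp only [List.mem_cons, List.not_mem_nil, or_false] at hs
    rcases hs with rfl | rfl | rfl
    · exact gok_mono (gok_numS _ _) (by decide)
    · exact gok_emit _ _
    · exact gok_loop (B := [SVar.Z]) (gok_g1S 0 _) (by decide) (by decide) (by decide)

/-- The input variable is not a loop index of the generator. [folklore] -/
theorem N0_notMem_loopVars_gen : SVar.N0 ∉ gen.loopVars := fun h => by
  have := gok_gen.2 _ h
  simp at this

/-- **The generator generates the description of the coin source.**
[cite: AroraBarakCC2009, §6.2 Def. 6.12] -/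
theorem out_gen (n : ℕ) :
    gen.out (GenProg.initEnv SVar.N0 n) =
      descTok n (hadFamily.ancillas n) (hadFamily.circ n) := by
  have hN : GenProg.initEnv SVar.N0 n SVar.N0 = n := GenProg.initEnv_self _ _
  rw [gen, out_seqs, descTok, circTok_hadFamily]
  simp only [List.flatMap_cons, List.flatMap_nil, List.append_nil, out_numS, GStmt.out,
    out_g1S, GExpr.eval, hN, Function.update_self]
  simp [lits, List.append_assoc]

end HadGen

/-- **The coin source is polynomial-time uniform** (`QCircuitFamily.isUniform_of_gen` with the
generator `HadGen.gen`). [cite: AroraBarakCC2009, §6.2 Def. 6.12] -/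
theorem hadFamily_isUniform : hadFamily.IsUniform :=
  QCircuitFamily.isUniform_of_gen hadFamily HadGen.gen BPPSim.SVar.N0
    HadGen.N0_notMem_loopVars_gen HadGen.gok_gen.1 HadGen.out_gen

/-! ### The output distribution of the coin source on `0^k` -/

/-- The padded all-zero input is all-zero. [folklore] -/
theorem padInput_get_zero (u : List Bool) (hu : ∀ i, u.get i = false) (i : Fin (u.length + 0)) :
    padInput u.get 0 i = false := by
  unfold padInput
  induction i using Fin.addCases with
  | left i => rw [Fin.append_left]; exact hu i
  | right i => exact i.elim0

/-- **`H^{⊗k} |0^k⟩ = 2^{-k/2} ∑_z |z⟩`**: on the all-zero input every amplitude of the coin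
source is `2^{-k/2}`. [Nielsen–Chuang 2010, §1.4.4] [cite: NielsenChuang2010, §1.4.4] -/
theorem hadFamily_runOn_apply (u : List Bool) (hu : ∀ i, u.get i = false)
    (z : QReg (u.length + 0)) :
    (hadFamily.circ u.length).runOn 0 (basisState (padInput u.get 0)) z =
      invSqrt2 ^ u.length := by
  have h := hadamards_mulVec_basisState (List.finRange u.length) (List.nodup_finRange _)
    (padInput u.get 0) (fun i _ => padInput_get_zero u hu i)
  have hz := congrFun h z
  rw [List.length_finRange, if_pos (fun j hj => absurd (List.mem_finRange j) hj)] at hz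
  exact hz

/-- **The coin source outputs a uniformly random string**: on the all-zero input `u = 0^k`, the
probability that the measured output lies in `E` is `uniformProb k E`.
[Bernstein–Vazirani 1997, proof of Thm. 8.3; Nielsen–Chuang 2010, §1.4.4, §2.2.5]
[cite: BernsteinVazirani1997, Thm. 8.3 (proof)] -/
theorem hadFamily_kernelProb (u : List Bool) (hu : ∀ i, u.get i = false) (E : Set (List Bool)) :
    hadFamily.kernelProb 0 u E = uniformProb u.length E := by
  classical
  unfold QCircuitFamily.kernelProb QCircuitFamily.kernel
  rw [toReal_outputPMF_map_ofFn, uniformProb_eq_card_ofFn]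
  show (∑ z : QReg (u.length + 0), if List.ofFn z ∈ E then
      ‖(hadFamily.circ u.length).runOn 0 (basisState (padInput u.get 0)) z‖ ^ 2 else 0) = _
  simp only [hadFamily_runOn_apply u hu, norm_invSqrt2_pow_sq]
  rw [Finset.sum_ite, Finset.sum_const_zero, add_zero, Finset.sum_const, nsmul_eq_mul,
    one_div, inv_pow, ← div_eq_mul_inv]
  rfl

/-! ### Pre- and post-processing -/

/-- The pre-processor: the all-zero coin register `0^{p|x|}`. [folklore] -/
def coinZeros (p : Polynomial ℕ) (x : List Bool) : List Bool :=
  List.replicate (p.eval x.length) false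

/-- `coinZeros p ∈ FP` (`0^{|·|}` after the unary polynomial `1^{p|x|}`).
[cite: AroraBarakCC2009, §1.3 (polynomial-time plumbing)] -/
theorem coinZeros_mem_FP (p : Polynomial ℕ) : coinZeros p ∈ FP := by
  have e : coinZeros p = Kannan.zerosFn ∘ Plumb.polyFn p := by
    funext x
    simp [coinZeros]
  rw [e]
  exact comp_mem_FP Kannan.zerosFn_mem_FP (Plumb.polyFn_mem_FP p)

/-- The post-processor: the accept bit `[w ∈ R]` followed by the post-selection bit `[w ∈ S]`.
[Bremner–Jozsa–Shepherd 2011, Def. 3 (output register, post-selection register)]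
[cite: BremnerJozsaShepherdPRSA2011, Def. 3] -/
def twoBits (R S : Language Bool) (w : List Bool) : List Bool :=
  encodeBool (R.boolIndicator w) ++ encodeBool (S.boolIndicator w)

/-- `twoBits R S w = [[w ∈ R], [w ∈ S]]`. [folklore] -/
theorem twoBits_eq (R S : Language Bool) (w : List Bool) :
    twoBits R S w = [R.boolIndicator w, S.boolIndicator w] := rfl

/-- For `R, S ∈ P`, `twoBits R S ∈ FP` (the two deciding machines, concatenated).
[cite: AroraBarakCC2009, Def. 1.13] -/
theorem twoBits_mem_FP {R S : Language Bool} (hR : R ∈ P) (hS : S ∈ P) : twoBits R S ∈ FP := by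
  unfold twoBits
  exact QuantumComplexity.append_mem_FP (indicatorFn_mem_FP hR) (indicatorFn_mem_FP hS)

/-- A two-letter prefix fixes the first two symbols. [folklore] -/
theorem getElem?_of_pair_isPrefix (a b : Bool) (z : List Bool) (h : [a, b] <+: z) :
    z[0]? = some a ∧ z[1]? = some b := by
  obtain ⟨t, rfl⟩ := h
  simp

/-! ### Born sums of a family: kernel, post-selection and joint acceptance -/

section Born

variable (W : QCircuitFamily cliffordT) (x : List Bool)

/-- The kernel probability of an event as a Born sum over the register.
(Nielsen–Chuang 2010, §2.2.5.) [cite: NielsenChuang2010, §2.2.5] -/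
theorem kernelProb_eq_sum (E : Set (List Bool)) [DecidablePred (· ∈ E)] :
    W.kernelProb 0 x E = ∑ z : QReg (x.length + W.ancillas x.length),
      if List.ofFn z ∈ E then
        ‖(W.circ x.length).runOn 0 (basisState (padInput x.get (W.ancillas x.length))) z‖ ^ 2
      else 0 :=
  toReal_outputPMF_map_ofFn _ _ _

/-- Reading symbol `i` of the measured string. [folklore] -/
theorem ofFn_getElem?_eq_some_iff {N : ℕ} (z : QReg N) (i : ℕ) (b : Bool) :
    (List.ofFn z)[i]? = some b ↔ ∃ h : i < N, z ⟨i, h⟩ = b := by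
  rw [List.getElem?_ofFn]
  by_cases h : i < N
  · rw [dif_pos h]; simp [h]
  · rw [dif_neg h]; simp [h]

/-- The post-selection event read on strings: symbol `1` is `1`. [cite: Aaronson2005, Def. 1] -/
theorem mem_postselectEvent_iff {N : ℕ} (z : QReg N) :
    z ∈ QCircuit.postselectEvent N ↔ (List.ofFn z)[1]? = some true := by
  rw [ofFn_getElem?_eq_some_iff]
  rfl

/-- The joint acceptance event read on strings: symbols `0` and `1` are `1`.
[cite: Aaronson2005, Def. 1] -/
theorem mem_jointAcceptEvent_iff {N : ℕ} (z : QReg N) :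
    z ∈ QCircuit.jointAcceptEvent N ↔
      (List.ofFn z)[0]? = some true ∧ (List.ofFn z)[1]? = some true := by
  rw [ofFn_getElem?_eq_some_iff, ofFn_getElem?_eq_some_iff]
  constructor
  · rintro ⟨h, h0, h1⟩
    exact ⟨⟨by omega, h0⟩, ⟨h, h1⟩⟩
  · rintro ⟨⟨_, h0⟩, ⟨h, h1⟩⟩
    exact ⟨h, h0, h1⟩

/-- **`Pr[post = 1]` as a kernel probability**: the post-selection probability is the
probability that the measured string has symbol `1` equal to `1`. [cite: Aaronson2005, Def. 1] -/
theorem postselectProbOn_eq_kernelProb :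
    W.postselectProbOn 0 x = W.kernelProb 0 x {w | w[1]? = some true} := by
  classical
  rw [kernelProb_eq_sum]
  unfold QCircuitFamily.postselectProbOn QCircuit.postselectProb QCircuit.probEvent
  rw [Finset.sum_filter]
  refine Finset.sum_congr rfl fun z _ => ?_
  by_cases hz : z ∈ QCircuit.postselectEvent (x.length + W.ancillas x.length)
  · have hz' : List.ofFn z ∈ {w : List Bool | w[1]? = some true} :=
      (mem_postselectEvent_iff z).1 hz
    rw [if_pos hz, if_pos hz']
  · have hz' : List.ofFn z ∉ {w : List Bool | w[1]? = some true} := fun h =>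
      hz ((mem_postselectEvent_iff z).2 h)
    rw [if_neg hz, if_neg hz']

/-- **`Pr[out = 1 ∧ post = 1]` as a kernel probability.** [cite: Aaronson2005, Def. 1] -/
theorem jointAcceptProbOn_eq_kernelProb :
    W.jointAcceptProbOn 0 x = W.kernelProb 0 x {w | w[0]? = some true ∧ w[1]? = some true} := by
  classical
  rw [kernelProb_eq_sum]
  unfold QCircuitFamily.jointAcceptProbOn QCircuit.jointAcceptProb QCircuit.probEvent
  rw [Finset.sum_filter]
  refine Finset.sum_congr rfl fun z _ => ?_
  by_cases hz : z ∈ QCircuit.jointAcceptEvent (x.length + W.ancillas x.length)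
  · have hz' : List.ofFn z ∈ {w : List Bool | w[0]? = some true ∧ w[1]? = some true} :=
      (mem_jointAcceptEvent_iff z).1 hz
    rw [if_pos hz, if_pos hz']
  · have hz' : List.ofFn z ∉ {w : List Bool | w[0]? = some true ∧ w[1]? = some true} :=
      fun h => hz ((mem_jointAcceptEvent_iff z).2 h)
    rw [if_neg hz, if_neg hz']

/-- Kernel probabilities are monotone in the event. [folklore] -/
theorem kernelProb_mono {A B : Set (List Bool)} (hAB : A ⊆ B) :
    W.kernelProb 0 x A ≤ W.kernelProb 0 x B := by
  classical
  rw [kernelProb_eq_sum, kernelProb_eq_sum]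
  refine Finset.sum_le_sum fun z _ => ?_
  by_cases hA : List.ofFn z ∈ A
  · rw [if_pos hA, if_pos (hAB hA)]
  · rw [if_neg hA]
    split_ifs <;> positivity

/-- **Disjoint events have kernel probabilities summing to at most `1`** (the output state is a
unit vector: Nielsen–Chuang 2010, eq. (2.95), probabilities sum to one).
[cite: NielsenChuang2010, §2.2.5] -/
theorem kernelProb_add_kernelProb_le_one {A B : Set (List Bool)} (hAB : ∀ w, w ∈ A → w ∉ B) :
    W.kernelProb 0 x A + W.kernelProb 0 x B ≤ 1 := by
  classical
  rw [kernelProb_eq_sum, kernelProb_eq_sum, ← Finset.sum_add_distrib]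
  have h1 := QCircuit.normSq_runOn_basisState cliffordT_isUnitary_holds 0 (W.circ x.length) x.get
  unfold normSq at h1
  rw [← h1]
  refine Finset.sum_le_sum fun z _ => ?_
  by_cases hA : List.ofFn z ∈ A
  · rw [if_pos hA, if_neg (hAB _ hA), add_zero]
  · rw [if_neg hA, zero_add]
    split_ifs
    · exact le_rfl
    · positivity

/-- **Exactness from two lower bounds**: if `Pr[A] ≥ a`, `Pr[B] ≥ 1 - a` and `A, B` are
disjoint, then `Pr[A] = a`. [folklore] -/
theorem kernelProb_eq_of_le_of_compl_le {A B : Set (List Bool)} {a : ℝ}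
    (hAB : ∀ w, w ∈ A → w ∉ B) (hA : a ≤ W.kernelProb 0 x A) (hB : 1 - a ≤ W.kernelProb 0 x B) :
    W.kernelProb 0 x A = a := by
  have := kernelProb_add_kernelProb_le_one W x hAB
  linarith

end Born

/-! ### The wrapped family -/

/-- **Classical wrapping of a uniform family** (the tree's `CWrap.family`, BV97 §8): for
`h, g ∈ FP` and an oracle-free uniform family `F` there is an oracle-free uniform family `W`
which, on input `x`, outputs a string with prefix `g ⟨x, y⟩` for an output `y ∈ E` of `F` on
`h x` with probability at least `Pr[F(h x) ∈ E]`, for every event `E`.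
[cite: BernsteinVazirani1997, §8 (classical computation inside quantum machines)] -/
theorem exists_wrap {h g : List Bool → List Bool} (hh : h ∈ FP) (hg : g ∈ FP)
    {F : QCircuitFamily cliffordT} (hfree : F.IsOracleFree) (hU : F.IsUniform) :
    ∃ W : QCircuitFamily cliffordT, W.IsOracleFree ∧ W.IsUniform ∧
      ∀ (x : List Bool) (E : Set (List Bool)),
        F.kernelProb 0 (h x) E ≤ W.kernelProb 0 x {z | ∃ y ∈ E, g (boolPair x y) <+: z} := by
  obtain ⟨Q, rfl, rfl, rfl⟩ := CWrap.exists_params hh hg hU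
  exact ⟨CWrap.family Q, CWrap.family_isOracleFree Q hfree, CWrap.family_isUniform Q hU,
    fun x E => CWrap.kernelProb_family_ge Q x fun _ => E⟩

/-- **The post-selected quantum simulation of a `PostBPP` computation.** For `R, S ∈ P` and a
coin polynomial `p` there is an oracle-free, polynomial-time uniform Clifford+T family whose
post-selection probability on `x` is exactly `Pr_r[⟨x,r⟩ ∈ S]` and whose joint acceptance
probability is exactly `Pr_r[⟨x,r⟩ ∈ S ∧ ⟨x,r⟩ ∈ R]` (`r` uniform in `{0,1}^{p|x|}`): Hadamard
coins, then the two polynomial-time predicates computed reversibly onto wires `0` and `1`.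
[Bremner–Jozsa–Shepherd 2011, Def. 3 and proof of Thm. 2 ("post-BPP ⊆ post-BQP");
Bernstein–Vazirani 1997, Thm. 8.3 (proof)] [cite: BremnerJozsaShepherdPRSA2011, Thm. 2 (proof)] -/
theorem exists_family {R S : Language Bool} (hR : R ∈ P) (hS : S ∈ P) (p : Polynomial ℕ) :
    ∃ W : QCircuitFamily cliffordT, W.IsOracleFree ∧ W.IsUniform ∧ ∀ x : List Bool,
      W.postselectProbOn 0 x = uniformProb (p.eval x.length) {r | boolPair x r ∈ S} ∧
      W.jointAcceptProbOn 0 x =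
        uniformProb (p.eval x.length) {r | boolPair x r ∈ S ∧ boolPair x r ∈ R} := by
  obtain ⟨W, hWfree, hWU, hW⟩ := exists_wrap (coinZeros_mem_FP p) (twoBits_mem_FP hR hS)
    hadFamily_isOracleFree hadFamily_isUniform
  refine ⟨W, hWfree, hWU, fun x => ?_⟩
  -- the coin source on `0^{p|x|}`
  have hu : ∀ i, (coinZeros p x).get i = false := fun i => by simp [coinZeros]
  have hlen : (coinZeros p x).length = p.eval x.length := by simp [coinZeros]
  have key : ∀ E : Set (List Bool), uniformProb (p.eval x.length) E ≤
      W.kernelProb 0 x {z | ∃ y ∈ E, twoBits R S (boolPair x y) <+: z} := by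
    intro E
    have := hW x E
    rwa [hadFamily_kernelProb (coinZeros p x) hu, hlen] at this
  -- reading the two bits off a prefix
  have hread : ∀ (y : List Bool) (z : List Bool), twoBits R S (boolPair x y) <+: z →
      z[0]? = some (R.boolIndicator (boolPair x y)) ∧
        z[1]? = some (S.boolIndicator (boolPair x y)) := fun y z hz =>
    getElem?_of_pair_isPrefix _ _ _ (by rwa [twoBits_eq] at hz)
  have hSt : ∀ {y : List Bool}, boolPair x y ∈ S → S.boolIndicator (boolPair x y) = true :=
    fun hy => (S.mem_iff_boolIndicator _).1 hy
  have hSf : ∀ {y : List Bool}, boolPair x y ∉ S → S.boolIndicator (boolPair x y) = false :=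
    fun hy => (S.notMem_iff_boolIndicator _).1 hy
  have hRt : ∀ {y : List Bool}, boolPair x y ∈ R → R.boolIndicator (boolPair x y) = true :=
    fun hy => (R.mem_iff_boolIndicator _).1 hy
  have hRf : ∀ {y : List Bool}, boolPair x y ∉ R → R.boolIndicator (boolPair x y) = false :=
    fun hy => (R.notMem_iff_boolIndicator _).1 hy
  constructor
  · -- the post-selection wire
    rw [postselectProbOn_eq_kernelProb]
    refine kernelProb_eq_of_le_of_compl_le W x (B := {w | w[1]? = some false}) ?_ ?_ ?_
    · intro w hw hw'
      rw [Set.mem_setOf_eq] at hw hw'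
      rw [hw] at hw'
      cases hw'
    · refine (key {r | boolPair x r ∈ S}).trans (kernelProb_mono W x ?_)
      rintro z ⟨y, hy, hz⟩
      rw [Set.mem_setOf_eq, (hread y z hz).2, hSt hy]
    · rw [← QuantumComplexity.uniformProb_compl]
      refine (key {r | boolPair x r ∈ S}ᶜ).trans (kernelProb_mono W x ?_)
      rintro z ⟨y, hy, hz⟩
      have hy' : boolPair x y ∉ S := hy
      rw [Set.mem_setOf_eq, (hread y z hz).2, hSf hy']
  · -- the joint event
    rw [jointAcceptProbOn_eq_kernelProb]
    refine kernelProb_eq_of_le_of_compl_le W x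
      (B := {w | w[0]? = some false ∨ w[1]? = some false}) ?_ ?_ ?_
    · rintro w ⟨h0, h1⟩ (h' | h')
      · rw [h0] at h'; cases h'
      · rw [h1] at h'; cases h'
    · refine (key {r | boolPair x r ∈ S ∧ boolPair x r ∈ R}).trans (kernelProb_mono W x ?_)
      rintro z ⟨y, ⟨hyS, hyR⟩, hz⟩
      exact ⟨by rw [(hread y z hz).1, hRt hyR], by rw [(hread y z hz).2, hSt hyS]⟩
    · rw [← QuantumComplexity.uniformProb_compl]
      refine (key {r | boolPair x r ∈ S ∧ boolPair x r ∈ R}ᶜ).trans (kernelProb_mono W x ?_)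
      rintro z ⟨y, hy, hz⟩
      have hy' : ¬ (boolPair x y ∈ S ∧ boolPair x y ∈ R) := hy
      by_cases hyS : boolPair x y ∈ S
      · have hyR : boolPair x y ∉ R := fun h' => hy' ⟨hyS, h'⟩
        left
        rw [(hread y z hz).1, hRf hyR]
      · right
        rw [(hread y z hz).2, hSf hyS]

end PostBPPSim

/-! ### The discharge -/

/-- **Discharge of `PostBPP_subset_PostBQP`** (`BPP_path = PostBPP ⊆ PostBQP`): given the
predicates `R, S ∈ P` and the coin polynomial `p` of `L ∈ PostBPP`, the family of
`PostBPPSim.exists_family` — Hadamard gates producing the uniform coins `r ∈ {0,1}^{p|x|}`, then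
the reversible polynomial-time computation of the post-selection bit `[⟨x,r⟩ ∈ S]` onto wire `1`
and of the accept bit `[⟨x,r⟩ ∈ R]` onto wire `0` (the tree's classical-wrap family, uniform and
oracle-free) — has `Pr[post = 1] = Pr_r[⟨x,r⟩ ∈ S] > 0` and
`Pr[out = 1 | post = 1] = Pr_r[⟨x,r⟩ ∈ S ∧ ⟨x,r⟩ ∈ R] / Pr_r[⟨x,r⟩ ∈ S]`, which is `≥ 2/3` on
`x ∈ L` and `≤ 1/3` off `L` by the `PostBPP` thresholds. Aaronson 2005, §2 introduces
`BPP_path` as classical probabilistic polynomial time with post-selection, the classical case of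
Def. 1; the inclusion is the remark "post-BPP ⊆ post-BQP" of Bremner–Jozsa–Shepherd 2011 (proof
of Thm. 2), by the simulation of Bernstein–Vazirani 1997, Thm. 8.3.
[cite: Aaronson2005, §2 and §3 Def. 1; BremnerJozsaShepherdPRSA2011, Thm. 2 (proof)] -/
theorem PostBPP_subset_PostBQP_holds : PostBPP_subset_PostBQP := by
  rintro L ⟨R, hR, S, hS, p, hL⟩
  obtain ⟨W, hWfree, hWU, hW⟩ := PostBPPSim.exists_family hR hS p
  refine ⟨W, hWfree, hWU, fun x => ?_⟩
  obtain ⟨hpos, hyes, hno⟩ := hL x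
  obtain ⟨hpost, hjoint⟩ := hW x
  refine ⟨by rw [hpost]; exact hpos, fun hx => ?_, fun hx => ?_⟩
  · show 2 / 3 ≤ W.jointAcceptProbOn 0 x / W.postselectProbOn 0 x
    rw [hpost, hjoint, le_div_iff₀ hpos]
    exact hyes hx
  · show W.jointAcceptProbOn 0 x / W.postselectProbOn 0 x ≤ 1 / 3
    rw [hpost, hjoint, div_le_iff₀ hpos]
    exact hno hx

end Literature.Computability.Cryptography

end
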